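import Mathlib
import Literature.NumberTheory.LFunctions.Zhang2022.AppendixBTailB3Weights
import HarnessLib

/-!
# Toolkit: unsmoothing a sharp cut-off `n < X` against the Gaussian weight `g(X/n)` of Zhang's (4.1)

Topic `Literature/NumberTheory/LFunctions/Zhang2022` (Landau–Siegel audit tree; verdict-neutral).
Y. Zhang, *Discrete mean estimates and the Landau–Siegel zero*, arXiv:2211.02515v1 (2022)
[Zhang2022LandauSiegel] — **an unrefereed manuscript under adjudication**; this file is a GENERIC
analytic tool (nothing here is a claim of the manuscript, and nothing is asserted about its
Theorems 1–2 or about Landau–Siegel zeros).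

Several displays of the manuscript replace a sharp sum `Σ_{n<X} a(n)/n` by the smoothed sum
`Σ_n a(n) n⁻¹ g(X/n)` with the weight `g` of (4.1) (`GaussWeight.gWeight Λ`, `Λ = 𝓛³⁰`) at the cost
of an error term, quoting only the pointwise estimates (4.2)–(4.3) ("By (4.2) and (4.3),
`Σ_{n<T} … = Σ_n … g(T/n) + O(α₁)`", §15 p.87 tex L4354, DAG `Z22:§15.u054`; "… + O(1/𝓛¹⁰)",
§16 p.94 tex L4657, DAG `Z22:§16.u040`). The summed error is controlled by the Gaussian window
`Σ_n |a(n)| n⁻¹ exp{−Λ log²(X/n)}`, which is small (`≪ Λ^{−1/2}` up to logarithms) as soon as the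
coefficients obey a SHORT-INTERVAL bound of Shiu–Brun–Titchmarsh shape. This file proves, for a
majorant `f ≥ |a|`:

* `abs_indicator_sub_gWeight_le` — `|1[n<X] − g(X/n)| ≤ ½ exp{−Λ log²(X/n)}` ((4.2)+(4.3));
* `norm_sum_Ico_sub_tsum_mul_gWeight_le` — the termwise comparison
  `‖Σ_{1≤n<X} a(n)/n − Σ_n a(n) n⁻¹ g(X/n)‖ ≤ ½ Σ_n f(n) n⁻¹ exp{−Λ log²(X/n)}`;
* `sum_Ioc_floor_le_of_shortInterval` — dyadic consequence of a short-interval hypothesis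
  `Σ_{x<n≤x+y} f(n) ≤ B y logᵏx` (`√x ≤ y ≤ x`, `x ≥ x₀`): `Σ_{x₀<n≤Y} f(n) ≤ 2 B Y logᵏY`;
* `sum_div_mul_gaussLog_le` / `tsum_div_mul_gaussLog_le` — the window bound
  `Σ_n f(n) n⁻¹ exp{−Λ log²(X/n)} ≤ 3^{k+3} (B logᵏX + F)/√Λ` for `e²x₀ ≤ X`,
  `max(4, k+1) ≤ Λ ≤ X/e²`, where `F` bounds `Σ_{n≤x₀} f(n)`;
* `norm_sum_Ico_sub_tsum_mul_gWeight_le_of_shortInterval` — the two combined.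

The short-interval hypothesis is the conclusion shape of Shiu's theorem (tree:
`Literature.NumberTheory.Sieve.Shiu1980BrunTitchmarsh_holds`, modulus `q = 1`).

## References

* Y. Zhang, arXiv:2211.02515v1 (2022), §4 (4.1)–(4.3) p.18; §15 p.87; §16 p.94.
  [cite: Zhang2022LandauSiegel, §4 (4.1)–(4.3)]
* P. Shiu, *A Brun–Titchmarsh theorem for multiplicative functions*, J. reine angew. Math. 313
  (1980) 161–170, Theorem 1. [cite: Shiu1980, Theorem 1]
-/

noncomputable section

open Real Finset MeasureTheory

namespace Literature.NumberTheory.LFunctions.Zhang2022.GaussWeight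

/-! ## §1. Termwise comparison of the sharp and the smoothed sum -/

/-- **(4.2)–(4.3) at `x = X/n`**: `|1[n < X] − g(X/n)| ≤ ½ exp{−Λ log²(X/n)}` for `n ≥ 1`
(the indicator of `n ∈ [1, ⌈X⌉)` is that of `n < X`).
[cite: Zhang2022LandauSiegel, §4 (4.2)–(4.3)] -/
theorem abs_indicator_sub_gWeight_le {Λ X : ℝ} (hΛ : 0 < Λ) (hX : 0 < X) {n : ℕ} (hn : 1 ≤ n) :
    |(if n ∈ Finset.Ico 1 ⌈X⌉₊ then (1 : ℝ) else 0) - gWeight Λ (X / n)| ≤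
      (1 / 2) * Real.exp (-Λ * Real.log (X / n) ^ 2) := by
  have hn0 : (0 : ℝ) < n := by exact_mod_cast hn
  have hx : 0 < X / n := div_pos hX hn0
  have h := AppendixBVarrho.abs_gWeight_sub_indicator_le hΛ hx
  have hiff : (n ∈ Finset.Ico 1 ⌈X⌉₊) ↔ (1 < X / n) := by
    rw [Finset.mem_Ico, one_lt_div hn0, Nat.lt_ceil]
    exact ⟨fun h => h.2, fun h => ⟨hn, h⟩⟩
  rw [abs_sub_comm]
  simp only [hiff]
  exact h

/-- **Termwise unsmoothing**: if `‖a(n)‖ ≤ f(n)` (`n ≥ 1`) and the Gaussian window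
`Σ_n f(n) n⁻¹ exp{−Λ log²(X/n)}` converges, then the smoothed series `Σ_n a(n) n⁻¹ g(X/n)`
converges and `‖Σ_{1≤n<X} a(n)/n − Σ_n a(n) n⁻¹ g(X/n)‖ ≤ ½ Σ_n f(n) n⁻¹ exp{−Λ log²(X/n)}`.
[cite: Zhang2022LandauSiegel, §4 (4.2)–(4.3)] -/
theorem norm_sum_Ico_sub_tsum_mul_gWeight_le {Λ X : ℝ} (hΛ : 0 < Λ) (hX : 0 < X)
    (a : ℕ → ℂ) (f : ℕ → ℝ) (haf : ∀ n : ℕ, 1 ≤ n → ‖a n‖ ≤ f n)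
    (hsum : Summable fun n : ℕ => f n / n * Real.exp (-Λ * Real.log (X / n) ^ 2)) :
    Summable (fun n : ℕ => a n / n * (gWeight Λ (X / n) : ℂ)) ∧
      ‖(∑ n ∈ Finset.Ico 1 ⌈X⌉₊, a n / n) - ∑' n : ℕ, a n / n * (gWeight Λ (X / n) : ℂ)‖ ≤
        (1 / 2) * ∑' n : ℕ, f n / n * Real.exp (-Λ * Real.log (X / n) ^ 2) := by
  classical
  -- the indicator of the sharp range and the termwise difference
  set ind : ℕ → ℂ := fun n => if n ∈ Finset.Ico 1 ⌈X⌉₊ then (1 : ℂ) else 0 with hind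
  set d : ℕ → ℂ := fun n => a n / n * (ind n - (gWeight Λ (X / n) : ℂ)) with hd
  have hbound : ∀ n : ℕ, ‖d n‖ ≤ (1 / 2) * (f n / n * Real.exp (-Λ * Real.log (X / n) ^ 2)) := by
    intro n
    rcases Nat.eq_zero_or_pos n with rfl | hn
    · simp [hd]
    · have hn1 : 1 ≤ n := hn
      have hn0 : (0 : ℝ) < n := by exact_mod_cast hn
      have h1 : ‖a n / (n : ℂ)‖ ≤ f n / n := by
        rw [norm_div, Complex.norm_natCast]
        exact div_le_div_of_nonneg_right (haf n hn1) hn0.le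
      have h2 : ‖ind n - (gWeight Λ (X / n) : ℂ)‖ ≤
          (1 / 2) * Real.exp (-Λ * Real.log (X / n) ^ 2) := by
        have : ind n - (gWeight Λ (X / n) : ℂ) =
            (((if n ∈ Finset.Ico 1 ⌈X⌉₊ then (1 : ℝ) else 0) - gWeight Λ (X / n) : ℝ) : ℂ) := by
          simp only [hind]
          split_ifs <;> push_cast <;> ring
        rw [this, Complex.norm_real, Real.norm_eq_abs]
        exact abs_indicator_sub_gWeight_le hΛ hX hn1
      have hf0 : 0 ≤ f n / n := le_trans (norm_nonneg _) h1
      calc ‖d n‖ = ‖a n / (n : ℂ)‖ * ‖ind n - (gWeight Λ (X / n) : ℂ)‖ := by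
            rw [hd]; exact norm_mul _ _
        _ ≤ (f n / n) * ((1 / 2) * Real.exp (-Λ * Real.log (X / n) ^ 2)) :=
            mul_le_mul h1 h2 (norm_nonneg _) hf0
        _ = (1 / 2) * (f n / n * Real.exp (-Λ * Real.log (X / n) ^ 2)) := by ring
  have hdsum : Summable d :=
    Summable.of_norm_bounded (hsum.mul_left (1 / 2)) hbound
  -- the sharp sum as a series against the indicator
  have hsharp_supp : ∀ n ∉ Finset.Ico 1 ⌈X⌉₊, a n / n * ind n = 0 := by
    intro n hn; simp only [hind, if_neg hn, mul_zero]
  have hsharp : ∑' n : ℕ, a n / n * ind n = ∑ n ∈ Finset.Ico 1 ⌈X⌉₊, a n / n := by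
    rw [tsum_eq_sum hsharp_supp]
    refine Finset.sum_congr rfl fun n hn => ?_
    simp only [hind, if_pos hn, mul_one]
  have hsharp_summable : Summable fun n : ℕ => a n / n * ind n :=
    summable_of_ne_finset_zero hsharp_supp
  -- the smoothed series is the sharp one minus the difference
  have hsmooth_eq : (fun n : ℕ => a n / n * (gWeight Λ (X / n) : ℂ)) =
      fun n => a n / n * ind n - d n := by
    funext n; simp only [hd]; ring
  have hsmooth : Summable fun n : ℕ => a n / n * (gWeight Λ (X / n) : ℂ) := by
    rw [hsmooth_eq]; exact hsharp_summable.sub hdsum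
  refine ⟨hsmooth, ?_⟩
  have hdiff : (∑ n ∈ Finset.Ico 1 ⌈X⌉₊, a n / n) -
      ∑' n : ℕ, a n / n * (gWeight Λ (X / n) : ℂ) = ∑' n : ℕ, d n := by
    rw [← hsharp, hsmooth_eq, hsharp_summable.tsum_sub hdsum]
    ring
  rw [hdiff]
  have hnorm : Summable fun n => ‖d n‖ := hdsum.norm
  calc ‖∑' n : ℕ, d n‖ ≤ ∑' n : ℕ, ‖d n‖ := norm_tsum_le_tsum_norm hnorm
    _ ≤ ∑' n : ℕ, (1 / 2) * (f n / n * Real.exp (-Λ * Real.log (X / n) ^ 2)) :=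
        hnorm.tsum_le_tsum hbound (hsum.mul_left (1 / 2))
    _ = (1 / 2) * ∑' n : ℕ, f n / n * Real.exp (-Λ * Real.log (X / n) ^ 2) := tsum_mul_left


/-! ## §2. From a short-interval bound to cumulative sums (dyadic induction) -/

/-- `Icc 1 N = Ioc 0 N` in `ℕ`. [folklore] -/
private theorem Icc_one_eq_Ioc_zero (N : ℕ) : Finset.Icc 1 N = Finset.Ioc 0 N := by
  ext n; simp only [Finset.mem_Icc, Finset.mem_Ioc]; omega

/-- `√x ≤ x` for `x ≥ 1`. [folklore] -/
private theorem sqrt_le_self_of_one_le {x : ℝ} (hx : 1 ≤ x) : Real.sqrt x ≤ x := by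
  rw [Real.sqrt_le_iff]
  exact ⟨by linarith, by nlinarith⟩

section ShortInterval

variable {f : ℕ → ℝ} {k : ℕ} {B x₀ : ℝ}

/-- **Dyadic consequence of a short-interval bound.** If `f ≥ 0` and
`Σ_{x<n≤x+y} f(n) ≤ B y logᵏx` whenever `x ≥ x₀ ≥ 1` and `√x ≤ y ≤ x`, then
`Σ_{x₀<n≤Y} f(n) ≤ 2 B Y logᵏY` for every `Y ≥ x₀`. [cite: Zhang2022LandauSiegel, §4 (4.2)–(4.3); §15 p.87] -/
theorem sum_Ioc_floor_le_of_shortInterval (hf : ∀ n, 0 ≤ f n) (hB : 0 ≤ B) (hx₀ : 1 ≤ x₀)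
    (hShort : ∀ x y : ℝ, x₀ ≤ x → Real.sqrt x ≤ y → y ≤ x →
      ∑ n ∈ Finset.Ioc ⌊x⌋₊ ⌊x + y⌋₊, f n ≤ B * y * Real.log x ^ k)
    {Y : ℝ} (hY : x₀ ≤ Y) :
    ∑ n ∈ Finset.Ioc ⌊x₀⌋₊ ⌊Y⌋₊, f n ≤ 2 * B * Y * Real.log Y ^ k := by
  suffices h : ∀ J : ℕ, ∀ Y : ℝ, x₀ ≤ Y → Y ≤ 2 ^ J * x₀ →
      ∑ n ∈ Finset.Ioc ⌊x₀⌋₊ ⌊Y⌋₊, f n ≤ 2 * B * Y * Real.log Y ^ k by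
    obtain ⟨J, hJ⟩ := pow_unbounded_of_one_lt (Y / x₀) (one_lt_two (α := ℝ))
    refine h J Y hY ?_
    rw [div_lt_iff₀ (by linarith)] at hJ
    exact hJ.le
  intro J
  induction J with
  | zero =>
    intro Y hY hY'
    have hYx : Y = x₀ := le_antisymm (by simpa using hY') hY
    rw [hYx, Finset.Ioc_self, Finset.sum_empty]
    have : 0 ≤ Real.log x₀ := Real.log_nonneg hx₀
    positivity
  | succ J ih =>
    intro Y hY hY'
    have hx₀0 : 0 < x₀ := by linarith
    have hY1 : 1 ≤ Y := le_trans hx₀ hY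
    have hY0 : 0 < Y := by linarith
    have hlogY : 0 ≤ Real.log Y := Real.log_nonneg hY1
    have hlogx₀ : 0 ≤ Real.log x₀ := Real.log_nonneg hx₀
    by_cases hcase : Y ≤ 2 * x₀
    · -- one short interval `(x₀, 2x₀]` covers `(x₀, Y]`
      have h1 := hShort x₀ x₀ le_rfl (sqrt_le_self_of_one_le hx₀) le_rfl
      have h2x : x₀ + x₀ = 2 * x₀ := by ring
      rw [h2x] at h1
      have hsub : Finset.Ioc ⌊x₀⌋₊ ⌊Y⌋₊ ⊆ Finset.Ioc ⌊x₀⌋₊ ⌊2 * x₀⌋₊ :=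
        Finset.Ioc_subset_Ioc_right (Nat.floor_le_floor hcase)
      have hlog : Real.log x₀ ^ k ≤ Real.log Y ^ k :=
        pow_le_pow_left₀ hlogx₀ (Real.log_le_log hx₀0 hY) k
      have hT : 0 ≤ B * Y * Real.log Y ^ k := mul_nonneg (mul_nonneg hB hY0.le) (pow_nonneg hlogY k)
      calc ∑ n ∈ Finset.Ioc ⌊x₀⌋₊ ⌊Y⌋₊, f n ≤ ∑ n ∈ Finset.Ioc ⌊x₀⌋₊ ⌊2 * x₀⌋₊, f n :=
            Finset.sum_le_sum_of_subset_of_nonneg hsub fun n _ _ => hf n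
        _ ≤ B * x₀ * Real.log x₀ ^ k := h1
        _ ≤ B * Y * Real.log Y ^ k := by gcongr
        _ ≤ 2 * B * Y * Real.log Y ^ k := by linarith
    · -- split at `Y/2 > x₀`
      rw [not_le] at hcase
      have hhalf : x₀ ≤ Y / 2 := by linarith
      have hhalf' : Y / 2 ≤ 2 ^ J * x₀ := by
        rw [pow_succ] at hY'; linarith
      have hhalf1 : 1 ≤ Y / 2 := le_trans hx₀ hhalf
      have hhalf0 : 0 < Y / 2 := by linarith
      have hA := ih (Y / 2) hhalf hhalf'
      have hB' := hShort (Y / 2) (Y / 2) hhalf (sqrt_le_self_of_one_le hhalf1) le_rfl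
      have h2 : Y / 2 + Y / 2 = Y := by ring
      rw [h2] at hB'
      have hsplit := Finset.sum_Ioc_consecutive f (Nat.floor_le_floor hhalf)
        (Nat.floor_le_floor (by linarith : Y / 2 ≤ Y))
      rw [← hsplit]
      have hlog : Real.log (Y / 2) ^ k ≤ Real.log Y ^ k :=
        pow_le_pow_left₀ (Real.log_nonneg hhalf1) (Real.log_le_log hhalf0 (by linarith)) k
      have hT : 0 ≤ B * Y * Real.log Y ^ k := mul_nonneg (mul_nonneg hB hY0.le) (pow_nonneg hlogY k)
      calc ∑ n ∈ Finset.Ioc ⌊x₀⌋₊ ⌊Y / 2⌋₊, f n + ∑ n ∈ Finset.Ioc ⌊Y / 2⌋₊ ⌊Y⌋₊, f n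
          ≤ 2 * B * (Y / 2) * Real.log (Y / 2) ^ k + B * (Y / 2) * Real.log (Y / 2) ^ k :=
            add_le_add hA hB'
        _ = (3 / 2) * (B * Y * Real.log (Y / 2) ^ k) := by ring
        _ ≤ (3 / 2) * (B * Y * Real.log Y ^ k) := by gcongr
        _ ≤ 2 * B * Y * Real.log Y ^ k := by linarith

/-- The cumulative form with the initial segment: if moreover `Σ_{1≤n≤x₀} f(n) ≤ F`, then
`Σ_{1≤n≤Y} f(n) ≤ F + 2 B Y logᵏY` for `Y ≥ x₀`. [cite: Zhang2022LandauSiegel, §4 (4.2)–(4.3); §15 p.87] -/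
theorem sum_Icc_floor_le_of_shortInterval (hf : ∀ n, 0 ≤ f n) (hB : 0 ≤ B) (hx₀ : 1 ≤ x₀)
    (hShort : ∀ x y : ℝ, x₀ ≤ x → Real.sqrt x ≤ y → y ≤ x →
      ∑ n ∈ Finset.Ioc ⌊x⌋₊ ⌊x + y⌋₊, f n ≤ B * y * Real.log x ^ k)
    {F : ℝ} (hSmall : ∑ n ∈ Finset.Icc 1 ⌊x₀⌋₊, f n ≤ F) {Y : ℝ} (hY : x₀ ≤ Y) :
    ∑ n ∈ Finset.Icc 1 ⌊Y⌋₊, f n ≤ F + 2 * B * Y * Real.log Y ^ k := by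
  rw [Icc_one_eq_Ioc_zero, ← Finset.sum_Ioc_consecutive f (Nat.zero_le _) (Nat.floor_le_floor hY),
    ← Icc_one_eq_Ioc_zero]
  exact add_le_add hSmall (sum_Ioc_floor_le_of_shortInterval hf hB hx₀ hShort hY)

/-! ## §3. The low range `n ≤ X/e`: there `exp{−Λ log²(X/n)} ≤ e^{1−Λ} n/X` -/

/-- For `1 ≤ n ≤ X/e` and `Λ ≥ 1`: `n⁻¹ exp{−Λ log²(X/n)} ≤ e^{1−Λ}/X`. [cite: Zhang2022LandauSiegel, §4 (4.2)–(4.3); §15 p.87] -/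
theorem inv_mul_gaussLog_le_low {Λ X : ℝ} (hΛ : 1 ≤ Λ) (hX : 0 < X) {n : ℕ} (hn : 1 ≤ n)
    (hnX : (n : ℝ) ≤ X / Real.exp 1) :
    (n : ℝ)⁻¹ * Real.exp (-Λ * Real.log (X / n) ^ 2) ≤ Real.exp (1 - Λ) / X := by
  have hn0 : (0 : ℝ) < n := by exact_mod_cast hn
  have he : 0 < Real.exp 1 := Real.exp_pos 1
  -- `u = X/n ≥ e`, `L = log u ≥ 1`
  have hu : Real.exp 1 ≤ X / n := by
    rw [le_div_iff₀ hn0]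
    calc Real.exp 1 * n ≤ Real.exp 1 * (X / Real.exp 1) := by gcongr
      _ = X := by field_simp
  have hu0 : 0 < X / n := lt_of_lt_of_le he hu
  have hL : 1 ≤ Real.log (X / n) := by
    rw [Real.le_log_iff_exp_le hu0]; exact hu
  -- `−Λ L² ≤ (1 − Λ) − L` since `(L−1)(Λ(L+1) − 1) ≥ 0`
  have hkey : -Λ * Real.log (X / n) ^ 2 ≤ (1 - Λ) - Real.log (X / n) := by
    nlinarith [mul_nonneg (sub_nonneg.mpr hL) (by nlinarith : 0 ≤ Λ * (Real.log (X / n) + 1) - 1)]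
  calc (n : ℝ)⁻¹ * Real.exp (-Λ * Real.log (X / n) ^ 2)
      ≤ (n : ℝ)⁻¹ * Real.exp ((1 - Λ) - Real.log (X / n)) := by
        gcongr
    _ = Real.exp (1 - Λ) / X := by
        rw [Real.exp_sub, Real.exp_log hu0]
        field_simp

/-- **Low range.** For `x₀ ≤ Y₀ ≤ X/e`, `Λ ≥ 1`:
`Σ_{1≤n≤Y₀} f(n) n⁻¹ exp{−Λ log²(X/n)} ≤ e^{1−Λ}(F + 2 B Y₀ logᵏY₀)/X`. [cite: Zhang2022LandauSiegel, §4 (4.2)–(4.3); §15 p.87] -/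
theorem sum_low_le (hf : ∀ n, 0 ≤ f n) (hB : 0 ≤ B) (hx₀ : 1 ≤ x₀)
    (hShort : ∀ x y : ℝ, x₀ ≤ x → Real.sqrt x ≤ y → y ≤ x →
      ∑ n ∈ Finset.Ioc ⌊x⌋₊ ⌊x + y⌋₊, f n ≤ B * y * Real.log x ^ k)
    {F : ℝ} (hSmall : ∑ n ∈ Finset.Icc 1 ⌊x₀⌋₊, f n ≤ F)
    {Λ X Y₀ : ℝ} (hΛ : 1 ≤ Λ) (hX : 0 < X) (hY₀ : x₀ ≤ Y₀) (hY₀X : Y₀ ≤ X / Real.exp 1) :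
    ∑ n ∈ Finset.Icc 1 ⌊Y₀⌋₊, f n / n * Real.exp (-Λ * Real.log (X / n) ^ 2) ≤
      Real.exp (1 - Λ) / X * (F + 2 * B * Y₀ * Real.log Y₀ ^ k) := by
  have hterm : ∀ n ∈ Finset.Icc 1 ⌊Y₀⌋₊,
      f n / n * Real.exp (-Λ * Real.log (X / n) ^ 2) ≤ Real.exp (1 - Λ) / X * f n := by
    intro n hn
    rw [Finset.mem_Icc] at hn
    have hnY : (n : ℝ) ≤ Y₀ := (Nat.le_floor_iff (by linarith : 0 ≤ Y₀)).mp hn.2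
    have h := inv_mul_gaussLog_le_low hΛ hX hn.1 (le_trans hnY hY₀X)
    calc f n / n * Real.exp (-Λ * Real.log (X / n) ^ 2)
        = f n * ((n : ℝ)⁻¹ * Real.exp (-Λ * Real.log (X / n) ^ 2)) := by ring
      _ ≤ f n * (Real.exp (1 - Λ) / X) := mul_le_mul_of_nonneg_left h (hf n)
      _ = Real.exp (1 - Λ) / X * f n := by ring
  calc ∑ n ∈ Finset.Icc 1 ⌊Y₀⌋₊, f n / n * Real.exp (-Λ * Real.log (X / n) ^ 2)
      ≤ ∑ n ∈ Finset.Icc 1 ⌊Y₀⌋₊, Real.exp (1 - Λ) / X * f n := Finset.sum_le_sum hterm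
    _ = Real.exp (1 - Λ) / X * ∑ n ∈ Finset.Icc 1 ⌊Y₀⌋₊, f n := by rw [Finset.mul_sum]
    _ ≤ Real.exp (1 - Λ) / X * (F + 2 * B * Y₀ * Real.log Y₀ ^ k) :=
        mul_le_mul_of_nonneg_left (sum_Icc_floor_le_of_shortInterval hf hB hx₀ hShort hSmall hY₀)
          (div_nonneg (Real.exp_pos _).le hX.le)

end ShortInterval

/-! ## §4. The high range `n > Y₁ ≥ eX` (dyadic blocks) -/

/-- `log(X/n)² = log(n/X)²`. [folklore] -/
private theorem log_div_sq_comm (X : ℝ) (n : ℕ) :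
    Real.log (X / n) ^ 2 = Real.log ((n : ℝ) / X) ^ 2 := by
  rw [← inv_div, Real.log_inv, neg_sq]

/-- `2^I = exp(I log 2)`. [folklore] -/
private theorem two_pow_eq_exp (I : ℕ) : (2 : ℝ) ^ I = Real.exp (I * Real.log 2) := by
  rw [Real.exp_nat_mul, Real.exp_log two_pos]

/-- Termwise bound on the dyadic block beyond `2^I Y₁` (`Y₁ ≥ eX`, `Λ ≥ 0`): for `n > 2^I Y₁`,
`n⁻¹ exp{−Λ log²(X/n)} ≤ e^{−Λ} e^{−2Λ I log 2} / (2^I Y₁)`. [cite: Zhang2022LandauSiegel, §4 (4.2)–(4.3); §15 p.87] -/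
theorem inv_mul_gaussLog_le_high {Λ X Y₁ : ℝ} (hΛ : 0 ≤ Λ) (hX : 0 < X)
    (hY₁ : Real.exp 1 * X ≤ Y₁) (I : ℕ) {n : ℕ} (hn : (2 : ℝ) ^ I * Y₁ < n) :
    (n : ℝ)⁻¹ * Real.exp (-Λ * Real.log (X / n) ^ 2) ≤
      Real.exp (-Λ) * Real.exp (-(2 * Λ * (I * Real.log 2))) / ((2 : ℝ) ^ I * Y₁) := by
  have he : 0 < Real.exp 1 := Real.exp_pos 1
  have hY₁0 : 0 < Y₁ := lt_of_lt_of_le (mul_pos he hX) hY₁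
  have hZ0 : 0 < (2 : ℝ) ^ I * Y₁ := by positivity
  have hn0 : 0 < (n : ℝ) := lt_trans hZ0 hn
  have hlog2 : 0 ≤ Real.log 2 := Real.log_nonneg one_le_two
  -- `v = log(n/X) ≥ 1 + I log 2`
  have hYX : 1 ≤ Real.log (Y₁ / X) := by
    rw [Real.le_log_iff_exp_le (div_pos hY₁0 hX), le_div_iff₀ hX]
    exact hY₁
  have hv : 1 + I * Real.log 2 ≤ Real.log ((n : ℝ) / X) := by
    have h1 : Real.log ((2 : ℝ) ^ I * Y₁ / X) ≤ Real.log ((n : ℝ) / X) :=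
      Real.log_le_log (div_pos hZ0 hX) (div_le_div_of_nonneg_right hn.le hX.le)
    have h2 : Real.log ((2 : ℝ) ^ I * Y₁ / X) = I * Real.log 2 + Real.log (Y₁ / X) := by
      rw [mul_div_assoc, Real.log_mul (by positivity) (div_pos hY₁0 hX).ne', Real.log_pow]
    linarith
  have hv0 : 0 ≤ 1 + I * Real.log 2 := by positivity
  have hsq : 1 + 2 * (I * Real.log 2) ≤ Real.log ((n : ℝ) / X) ^ 2 := by
    have h1 : (1 + I * Real.log 2) ^ 2 ≤ Real.log ((n : ℝ) / X) ^ 2 :=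
      pow_le_pow_left₀ hv0 hv 2
    nlinarith [mul_nonneg (Nat.cast_nonneg I) hlog2]
  have hw : Real.exp (-Λ * Real.log (X / n) ^ 2) ≤
      Real.exp (-Λ) * Real.exp (-(2 * Λ * (I * Real.log 2))) := by
    rw [← Real.exp_add, Real.exp_le_exp, log_div_sq_comm]
    have := mul_le_mul_of_nonneg_left hsq hΛ
    linarith
  have hinv : (n : ℝ)⁻¹ ≤ ((2 : ℝ) ^ I * Y₁)⁻¹ := by
    rw [inv_le_inv₀ hn0 hZ0]; exact hn.le
  calc (n : ℝ)⁻¹ * Real.exp (-Λ * Real.log (X / n) ^ 2)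
      ≤ ((2 : ℝ) ^ I * Y₁)⁻¹ * (Real.exp (-Λ) * Real.exp (-(2 * Λ * (I * Real.log 2)))) :=
        mul_le_mul hinv hw (Real.exp_pos _).le (inv_nonneg.mpr hZ0.le)
    _ = Real.exp (-Λ) * Real.exp (-(2 * Λ * (I * Real.log 2))) / ((2 : ℝ) ^ I * Y₁) := by
        rw [div_eq_inv_mul]

/-- The logarithm on the dyadic block: for `Y₁ ≥ e` and `2Λ ≥ k+1`,
`e^{−2Λ I log 2} logᵏ(2^I Y₁) ≤ 2^{−I} logᵏY₁`. [cite: Zhang2022LandauSiegel, §4 (4.2)–(4.3); §15 p.87] -/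
theorem exp_mul_log_pow_le_high {k : ℕ} {Λ Y₁ : ℝ} (hΛk : (k : ℝ) + 1 ≤ 2 * Λ)
    (hY₁ : Real.exp 1 ≤ Y₁) (I : ℕ) :
    Real.exp (-(2 * Λ * (I * Real.log 2))) * Real.log ((2 : ℝ) ^ I * Y₁) ^ k ≤
      (1 / 2) ^ I * Real.log Y₁ ^ k := by
  have he : 0 < Real.exp 1 := Real.exp_pos 1
  have hY₁0 : 0 < Y₁ := lt_of_lt_of_le he hY₁
  have hlog2 : 0 ≤ Real.log 2 := Real.log_nonneg one_le_two
  have hlog2' : Real.log 2 ≤ 1 := by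
    have := Real.log_two_lt_d9; linarith
  have hL : 1 ≤ Real.log Y₁ := by rwa [Real.le_log_iff_exp_le hY₁0]
  -- `log(2^I Y₁) ≤ (1+I) log Y₁ ≤ 2^I log Y₁ = exp(I log 2) log Y₁`
  have hI : (1 : ℝ) + I ≤ (2 : ℝ) ^ I := by
    have h := Nat.lt_two_pow_self (n := I)
    have h' : I + 1 ≤ 2 ^ I := h
    calc (1 : ℝ) + I = ((I + 1 : ℕ) : ℝ) := by push_cast; ring
      _ ≤ ((2 ^ I : ℕ) : ℝ) := by exact_mod_cast h'
      _ = (2 : ℝ) ^ I := by push_cast; ring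
  have hlogZ : Real.log ((2 : ℝ) ^ I * Y₁) ≤ Real.exp (I * Real.log 2) * Real.log Y₁ := by
    rw [Real.log_mul (by positivity) hY₁0.ne', Real.log_pow, ← two_pow_eq_exp]
    calc (I : ℝ) * Real.log 2 + Real.log Y₁ ≤ I * 1 + Real.log Y₁ := by gcongr
      _ ≤ (1 + I) * Real.log Y₁ := by nlinarith
      _ ≤ (2 : ℝ) ^ I * Real.log Y₁ := by gcongr
  have hlogZ0 : 0 ≤ Real.log ((2 : ℝ) ^ I * Y₁) := by
    apply Real.log_nonneg
    calc (1 : ℝ) ≤ Y₁ := le_trans (by linarith [Real.add_one_le_exp (1 : ℝ)]) hY₁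
      _ ≤ (2 : ℝ) ^ I * Y₁ := le_mul_of_one_le_left hY₁0.le (one_le_pow₀ one_le_two)
  have hpow : Real.log ((2 : ℝ) ^ I * Y₁) ^ k ≤
      Real.exp (k * (I * Real.log 2)) * Real.log Y₁ ^ k := by
    calc Real.log ((2 : ℝ) ^ I * Y₁) ^ k ≤ (Real.exp (I * Real.log 2) * Real.log Y₁) ^ k :=
          pow_le_pow_left₀ hlogZ0 hlogZ k
      _ = Real.exp (k * (I * Real.log 2)) * Real.log Y₁ ^ k := by
          rw [mul_pow, ← Real.exp_nat_mul]
  -- `e^{−2ΛI log 2} e^{kI log 2} ≤ e^{−I log 2} = 2^{−I}`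
  have hexp : Real.exp (-(2 * Λ * (I * Real.log 2))) * Real.exp (k * (I * Real.log 2)) ≤
      (1 / 2) ^ I := by
    rw [← Real.exp_add, one_div, inv_pow, two_pow_eq_exp, ← Real.exp_neg, Real.exp_le_exp]
    have h0 : 0 ≤ (I : ℝ) * Real.log 2 := by positivity
    nlinarith
  calc Real.exp (-(2 * Λ * (I * Real.log 2))) * Real.log ((2 : ℝ) ^ I * Y₁) ^ k
      ≤ Real.exp (-(2 * Λ * (I * Real.log 2))) *
          (Real.exp (k * (I * Real.log 2)) * Real.log Y₁ ^ k) :=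
        mul_le_mul_of_nonneg_left hpow (Real.exp_pos _).le
    _ = (Real.exp (-(2 * Λ * (I * Real.log 2))) * Real.exp (k * (I * Real.log 2))) *
          Real.log Y₁ ^ k := by ring
    _ ≤ (1 / 2) ^ I * Real.log Y₁ ^ k :=
        mul_le_mul_of_nonneg_right hexp (pow_nonneg (by linarith) k)

section HighRange

variable {f : ℕ → ℝ} {k : ℕ} {B x₀ : ℝ}

/-- **High range.** For `Y₁ ≥ max(eX, x₀)`, `X ≥ 1`, `2Λ ≥ k+1`, every `N`:
`Σ_{Y₁<n≤N} f(n) n⁻¹ exp{−Λ log²(X/n)} ≤ 2 B e^{−Λ} logᵏY₁`. [cite: Zhang2022LandauSiegel, §4 (4.2)–(4.3); §15 p.87] -/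
theorem sum_high_le (hf : ∀ n, 0 ≤ f n) (hB : 0 ≤ B) (hx₀ : 1 ≤ x₀)
    (hShort : ∀ x y : ℝ, x₀ ≤ x → Real.sqrt x ≤ y → y ≤ x →
      ∑ n ∈ Finset.Ioc ⌊x⌋₊ ⌊x + y⌋₊, f n ≤ B * y * Real.log x ^ k)
    {Λ X Y₁ : ℝ} (hΛ : 0 ≤ Λ) (hΛk : (k : ℝ) + 1 ≤ 2 * Λ) (hX : 1 ≤ X)
    (hY₁ : Real.exp 1 * X ≤ Y₁) (hY₁' : x₀ ≤ Y₁) (N : ℕ) :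
    ∑ n ∈ Finset.Ioc ⌊Y₁⌋₊ N, f n / n * Real.exp (-Λ * Real.log (X / n) ^ 2) ≤
      2 * B * Real.exp (-Λ) * Real.log Y₁ ^ k := by
  have he : 0 < Real.exp 1 := Real.exp_pos 1
  have hX0 : 0 < X := by linarith
  have hY₁e : Real.exp 1 ≤ Y₁ := le_trans (by nlinarith) hY₁
  have hY₁0 : 0 < Y₁ := lt_of_lt_of_le he hY₁e
  have hY₁1 : 1 ≤ Y₁ := le_trans hx₀ hY₁'
  have hL0 : 0 ≤ Real.log Y₁ := Real.log_nonneg hY₁1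
  set K : ℝ := B * Real.exp (-Λ) * Real.log Y₁ ^ k with hK
  have hK0 : 0 ≤ K := by positivity
  suffices h : ∀ I : ℕ, ∀ N : ℕ, (N : ℝ) ≤ 2 ^ I * Y₁ →
      ∑ n ∈ Finset.Ioc ⌊Y₁⌋₊ N, f n / n * Real.exp (-Λ * Real.log (X / n) ^ 2) ≤
        2 * K * (1 - (1 / 2) ^ I) by
    obtain ⟨I, hI⟩ := pow_unbounded_of_one_lt ((N : ℝ) / Y₁) (one_lt_two (α := ℝ))
    have hI' : (N : ℝ) ≤ 2 ^ I * Y₁ := by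
      rw [div_lt_iff₀ hY₁0] at hI; exact hI.le
    calc _ ≤ 2 * K * (1 - (1 / 2) ^ I) := h I N hI'
      _ ≤ 2 * K * 1 := by
          gcongr
          linarith [pow_nonneg (by norm_num : (0 : ℝ) ≤ 1 / 2) I]
      _ = 2 * B * Real.exp (-Λ) * Real.log Y₁ ^ k := by rw [hK]; ring
  intro I
  induction I with
  | zero =>
    intro N hN
    have hN' : N ≤ ⌊Y₁⌋₊ := Nat.le_floor (by simpa using hN)
    rw [Finset.Ioc_eq_empty (fun h => absurd (lt_of_lt_of_le h hN') (lt_irrefl _)),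
      Finset.sum_empty]
    simp
  | succ I ih =>
    intro N hN
    have hZ0 : 0 < (2 : ℝ) ^ I * Y₁ := by positivity
    have hmono : 2 * K * (1 - (1 / 2) ^ I) ≤ 2 * K * (1 - (1 / 2) ^ (I + 1)) := by
      have : ((1 : ℝ) / 2) ^ (I + 1) ≤ (1 / 2) ^ I :=
        pow_le_pow_of_le_one (by norm_num) (by norm_num) (Nat.le_succ I)
      nlinarith
    by_cases hc : (N : ℝ) ≤ 2 ^ I * Y₁
    · exact le_trans (ih N hc) hmono
    · rw [not_le] at hc
      -- split at `⌊2^I Y₁⌋`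
      have h1 : ⌊Y₁⌋₊ ≤ ⌊(2 : ℝ) ^ I * Y₁⌋₊ :=
        Nat.floor_le_floor (le_mul_of_one_le_left hY₁0.le (one_le_pow₀ one_le_two))
      have h2 : ⌊(2 : ℝ) ^ I * Y₁⌋₊ ≤ N := ((Nat.floor_lt hZ0.le).mpr hc).le
      rw [← Finset.sum_Ioc_consecutive _ h1 h2]
      have hA := ih ⌊(2 : ℝ) ^ I * Y₁⌋₊ (Nat.floor_le hZ0.le)
      -- the block `(2^I Y₁, N] ⊆ (2^I Y₁, 2^{I+1} Y₁]`
      have hterm : ∀ n ∈ Finset.Ioc ⌊(2 : ℝ) ^ I * Y₁⌋₊ N,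
          f n / n * Real.exp (-Λ * Real.log (X / n) ^ 2) ≤
            f n * (Real.exp (-Λ) * Real.exp (-(2 * Λ * (I * Real.log 2))) /
              ((2 : ℝ) ^ I * Y₁)) := by
        intro n hn
        rw [Finset.mem_Ioc] at hn
        have hn' : (2 : ℝ) ^ I * Y₁ < n := (Nat.floor_lt hZ0.le).mp hn.1
        have h := inv_mul_gaussLog_le_high hΛ hX0 hY₁ I hn'
        calc f n / n * Real.exp (-Λ * Real.log (X / n) ^ 2)
            = f n * ((n : ℝ)⁻¹ * Real.exp (-Λ * Real.log (X / n) ^ 2)) := by ring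
          _ ≤ _ := mul_le_mul_of_nonneg_left h (hf n)
      have hsub : Finset.Ioc ⌊(2 : ℝ) ^ I * Y₁⌋₊ N ⊆
          Finset.Ioc ⌊(2 : ℝ) ^ I * Y₁⌋₊ ⌊(2 : ℝ) ^ I * Y₁ + (2 : ℝ) ^ I * Y₁⌋₊ := by
        refine Finset.Ioc_subset_Ioc_right (Nat.le_floor ?_)
        rw [pow_succ] at hN; linarith
      have hge : x₀ ≤ (2 : ℝ) ^ I * Y₁ :=
        le_trans hY₁' (le_mul_of_one_le_left hY₁0.le (one_le_pow₀ one_le_two))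
      have hge1 : 1 ≤ (2 : ℝ) ^ I * Y₁ := le_trans hx₀ hge
      have hblock : ∑ n ∈ Finset.Ioc ⌊(2 : ℝ) ^ I * Y₁⌋₊ N, f n ≤
          B * ((2 : ℝ) ^ I * Y₁) * Real.log ((2 : ℝ) ^ I * Y₁) ^ k := by
        have hs := hShort ((2 : ℝ) ^ I * Y₁) ((2 : ℝ) ^ I * Y₁) hge
          (sqrt_le_self_of_one_le hge1) le_rfl
        exact le_trans (Finset.sum_le_sum_of_subset_of_nonneg hsub fun n _ _ => hf n) hs
      have hB2 : ∑ n ∈ Finset.Ioc ⌊(2 : ℝ) ^ I * Y₁⌋₊ N,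
          f n / n * Real.exp (-Λ * Real.log (X / n) ^ 2) ≤ K * (1 / 2) ^ I := by
        calc ∑ n ∈ Finset.Ioc ⌊(2 : ℝ) ^ I * Y₁⌋₊ N,
              f n / n * Real.exp (-Λ * Real.log (X / n) ^ 2)
            ≤ ∑ n ∈ Finset.Ioc ⌊(2 : ℝ) ^ I * Y₁⌋₊ N,
                f n * (Real.exp (-Λ) * Real.exp (-(2 * Λ * (I * Real.log 2))) /
                  ((2 : ℝ) ^ I * Y₁)) := Finset.sum_le_sum hterm
          _ = (∑ n ∈ Finset.Ioc ⌊(2 : ℝ) ^ I * Y₁⌋₊ N, f n) *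
                (Real.exp (-Λ) * Real.exp (-(2 * Λ * (I * Real.log 2))) /
                  ((2 : ℝ) ^ I * Y₁)) := by rw [Finset.sum_mul]
          _ ≤ (B * ((2 : ℝ) ^ I * Y₁) * Real.log ((2 : ℝ) ^ I * Y₁) ^ k) *
                (Real.exp (-Λ) * Real.exp (-(2 * Λ * (I * Real.log 2))) /
                  ((2 : ℝ) ^ I * Y₁)) :=
              mul_le_mul_of_nonneg_right hblock (by positivity)
          _ = B * Real.exp (-Λ) *
                (Real.exp (-(2 * Λ * (I * Real.log 2))) * Real.log ((2 : ℝ) ^ I * Y₁) ^ k) := by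
              field_simp
          _ ≤ B * Real.exp (-Λ) * ((1 / 2) ^ I * Real.log Y₁ ^ k) :=
              mul_le_mul_of_nonneg_left (exp_mul_log_pow_le_high hΛk hY₁e I) (by positivity)
          _ = K * (1 / 2) ^ I := by rw [hK]; ring
      calc _ ≤ 2 * K * (1 - (1 / 2) ^ I) + K * (1 / 2) ^ I := add_le_add hA hB2
        _ = 2 * K * (1 - (1 / 2) ^ (I + 1)) := by rw [pow_succ]; ring

end HighRange

/-! ## §5. The middle range `X e^{−Mh} < n ≤ X e^{Mh}`: blocks of logarithmic width `h = Λ^{−1/2}` -/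

/-- `Σ_{i<t} e^{−i²} ≤ 2` (compare with the geometric series `Σ 2^{−i}`). [folklore] -/
private theorem sum_exp_neg_sq_le_two (t : ℕ) :
    ∑ i ∈ Finset.range t, Real.exp (-((i : ℝ) ^ 2)) ≤ 2 := by
  have he : Real.exp (-1) ≤ 1 / 2 := by
    have h2 : (2 : ℝ) ≤ Real.exp 1 := by linarith [Real.add_one_le_exp (1 : ℝ)]
    rw [Real.exp_neg, one_div]
    exact inv_anti₀ two_pos h2
  calc ∑ i ∈ Finset.range t, Real.exp (-((i : ℝ) ^ 2))
      ≤ ∑ i ∈ Finset.range t, ((1 : ℝ) / 2) ^ i := by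
        refine Finset.sum_le_sum fun i _ => ?_
        have hi : (i : ℝ) ≤ (i : ℝ) ^ 2 := by
          rcases Nat.eq_zero_or_pos i with rfl | hi
          · simp
          · have : (1 : ℝ) ≤ i := by exact_mod_cast hi
            nlinarith
        calc Real.exp (-((i : ℝ) ^ 2)) ≤ Real.exp (-(i : ℝ)) := Real.exp_le_exp.mpr (by linarith)
          _ = Real.exp (-1) ^ i := by rw [← Real.exp_nat_mul]; ring_nf
          _ ≤ ((1 : ℝ) / 2) ^ i := pow_le_pow_left₀ (Real.exp_pos _).le he i
    _ ≤ 2 := sum_geometric_two_le t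

section FineBlocks

variable {f : ℕ → ℝ} {k : ℕ} {B x₀ : ℝ}

/-- **One block of logarithmic width `h = Λ^{−1/2}`**: if `x ≥ max(x₀, Λ)` and the Gaussian factor is
`≤ c` on `(x, x eʰ]`, then `Σ_{x<n≤xeʰ} f(n) n⁻¹ exp{−Λ log²(X/n)} ≤ 2 h B c logᵏx`. [cite: Zhang2022LandauSiegel, §4 (4.2)–(4.3); §15 p.87] -/
theorem sum_block_le (hf : ∀ n, 0 ≤ f n) (hB : 0 ≤ B) (hx₀ : 1 ≤ x₀)
    (hShort : ∀ x y : ℝ, x₀ ≤ x → Real.sqrt x ≤ y → y ≤ x →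
      ∑ n ∈ Finset.Ioc ⌊x⌋₊ ⌊x + y⌋₊, f n ≤ B * y * Real.log x ^ k)
    {Λ X x h c : ℝ} (hh : h = 1 / Real.sqrt Λ) (hΛ : 4 ≤ Λ) (hx : x₀ ≤ x) (hxΛ : Λ ≤ x)
    (hc : 0 ≤ c)
    (hw : ∀ n : ℕ, x < n → (n : ℝ) ≤ x * Real.exp h →
      Real.exp (-Λ * Real.log (X / n) ^ 2) ≤ c) :
    ∑ n ∈ Finset.Ioc ⌊x⌋₊ ⌊x * Real.exp h⌋₊, f n / n * Real.exp (-Λ * Real.log (X / n) ^ 2) ≤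
      2 * h * B * c * Real.log x ^ k := by
  have hΛ0 : 0 < Λ := by linarith
  have hsΛ : 2 ≤ Real.sqrt Λ := by
    rw [show (2 : ℝ) = Real.sqrt 4 by rw [show (4 : ℝ) = 2 ^ 2 by norm_num,
      Real.sqrt_sq (by norm_num : (0 : ℝ) ≤ 2)]]
    exact Real.sqrt_le_sqrt hΛ
  have hsΛ0 : 0 < Real.sqrt Λ := by linarith
  have hh0 : 0 < h := by rw [hh]; positivity
  have hh1 : h ≤ 1 / 2 := by
    rw [hh, div_le_div_iff₀ hsΛ0 two_pos]; linarith
  have hx1 : 1 ≤ x := le_trans hx₀ hx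
  have hx0 : 0 < x := by linarith
  have hlogx : 0 ≤ Real.log x := Real.log_nonneg hx1
  -- `h ≤ eʰ − 1 ≤ 2h` and `eʰ − 1 ≤ 1`
  have hexp1 : h ≤ Real.exp h - 1 := by linarith [Real.add_one_le_exp h]
  have hexp2 : Real.exp h - 1 ≤ h + h ^ 2 := by
    have := Real.abs_exp_sub_one_sub_id_le (x := h) (by rw [abs_of_pos hh0]; linarith)
    rw [abs_le] at this
    linarith [this.2]
  have hexp3 : Real.exp h - 1 ≤ 2 * h := by nlinarith
  have hexp4 : Real.exp h - 1 ≤ 1 := by nlinarith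
  -- the short interval `y = x(eʰ − 1)`
  set y : ℝ := x * (Real.exp h - 1) with hy
  have hxy : x + y = x * Real.exp h := by rw [hy]; ring
  have hy1 : Real.sqrt x ≤ y := by
    have hsx : Real.sqrt Λ ≤ Real.sqrt x := Real.sqrt_le_sqrt hxΛ
    have hsx0 : 0 ≤ Real.sqrt x := Real.sqrt_nonneg x
    have h1 : 1 ≤ Real.sqrt x * h := by
      rw [hh]
      calc (1 : ℝ) = Real.sqrt Λ * (1 / Real.sqrt Λ) := by field_simp
        _ ≤ Real.sqrt x * (1 / Real.sqrt Λ) := by gcongr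
    calc Real.sqrt x = Real.sqrt x * 1 := (mul_one _).symm
      _ ≤ Real.sqrt x * (Real.sqrt x * h) := mul_le_mul_of_nonneg_left h1 hsx0
      _ = x * h := by rw [← mul_assoc, Real.mul_self_sqrt hx0.le]
      _ ≤ y := by rw [hy]; exact mul_le_mul_of_nonneg_left hexp1 hx0.le
  have hy2 : y ≤ x := by
    calc y ≤ x * 1 := mul_le_mul_of_nonneg_left hexp4 hx0.le
      _ = x := mul_one x
  have hS := hShort x y hx hy1 hy2
  rw [hxy] at hS
  -- termwise: `f(n) n⁻¹ exp{…} ≤ f(n) c / x`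
  have hterm : ∀ n ∈ Finset.Ioc ⌊x⌋₊ ⌊x * Real.exp h⌋₊,
      f n / n * Real.exp (-Λ * Real.log (X / n) ^ 2) ≤ f n * (c / x) := by
    intro n hn
    rw [Finset.mem_Ioc] at hn
    have hn1 : x < n := (Nat.floor_lt hx0.le).mp hn.1
    have hn2 : (n : ℝ) ≤ x * Real.exp h :=
      le_trans (by exact_mod_cast hn.2) (Nat.floor_le (by positivity))
    have hn0 : 0 < (n : ℝ) := lt_trans hx0 hn1
    have hinv : (n : ℝ)⁻¹ ≤ x⁻¹ := by rw [inv_le_inv₀ hn0 hx0]; exact hn1.le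
    calc f n / n * Real.exp (-Λ * Real.log (X / n) ^ 2)
        = f n * ((n : ℝ)⁻¹ * Real.exp (-Λ * Real.log (X / n) ^ 2)) := by ring
      _ ≤ f n * (x⁻¹ * c) :=
          mul_le_mul_of_nonneg_left (mul_le_mul hinv (hw n hn1 hn2) (Real.exp_pos _).le
            (inv_nonneg.mpr hx0.le)) (hf n)
      _ = f n * (c / x) := by rw [div_eq_inv_mul]
  calc ∑ n ∈ Finset.Ioc ⌊x⌋₊ ⌊x * Real.exp h⌋₊, f n / n * Real.exp (-Λ * Real.log (X / n) ^ 2)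
      ≤ ∑ n ∈ Finset.Ioc ⌊x⌋₊ ⌊x * Real.exp h⌋₊, f n * (c / x) := Finset.sum_le_sum hterm
    _ = (∑ n ∈ Finset.Ioc ⌊x⌋₊ ⌊x * Real.exp h⌋₊, f n) * (c / x) := by rw [Finset.sum_mul]
    _ ≤ (B * y * Real.log x ^ k) * (c / x) :=
        mul_le_mul_of_nonneg_right hS (div_nonneg hc hx0.le)
    _ = B * (Real.exp h - 1) * c * Real.log x ^ k := by rw [hy]; field_simp
    _ ≤ B * (2 * h) * c * Real.log x ^ k := by gcongr
    _ = 2 * h * B * c * Real.log x ^ k := by ring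

/-- Gaussian factor on a block to the RIGHT of `X`: for `n > X e^{th}` (`t ≥ 0`, `h = Λ^{−1/2}`),
`exp{−Λ log²(X/n)} ≤ e^{−t²}`. [cite: Zhang2022LandauSiegel, §4 (4.2)–(4.3); §15 p.87] -/
theorem gaussLog_le_right {Λ X h : ℝ} (hX : 0 < X) (hΛ : 0 < Λ) (hh : h = 1 / Real.sqrt Λ)
    (t : ℕ) {n : ℕ} (hn : X * Real.exp (t * h) < n) :
    Real.exp (-Λ * Real.log (X / n) ^ 2) ≤ Real.exp (-((t : ℝ) ^ 2)) := by
  have hx0 : 0 < X * Real.exp (t * h) := by positivity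
  have hn0 : 0 < (n : ℝ) := lt_trans hx0 hn
  have hh0 : 0 ≤ h := by rw [hh]; positivity
  have hth : 0 ≤ (t : ℝ) * h := by positivity
  have hlog : (t : ℝ) * h ≤ Real.log ((n : ℝ) / X) := by
    have h1 : Real.log (X * Real.exp (t * h) / X) ≤ Real.log ((n : ℝ) / X) :=
      Real.log_le_log (div_pos hx0 hX) (div_le_div_of_nonneg_right hn.le hX.le)
    rwa [mul_div_cancel_left₀ _ hX.ne', Real.log_exp] at h1
  have hsq : ((t : ℝ) * h) ^ 2 ≤ Real.log ((n : ℝ) / X) ^ 2 := pow_le_pow_left₀ hth hlog 2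
  have hh2 : Λ * h ^ 2 = 1 := by
    rw [hh, div_pow, one_pow, Real.sq_sqrt hΛ.le]; field_simp
  rw [Real.exp_le_exp, log_div_sq_comm]
  have := mul_le_mul_of_nonneg_left hsq hΛ.le
  calc -Λ * Real.log ((n : ℝ) / X) ^ 2 ≤ -(Λ * ((t : ℝ) * h) ^ 2) := by linarith
    _ = -((t : ℝ) ^ 2 * (Λ * h ^ 2)) := by ring
    _ = -((t : ℝ) ^ 2) := by rw [hh2, mul_one]

/-- Gaussian factor on a block to the LEFT of `X`: for `0 < n ≤ X e^{−th}` (`t ≥ 0`,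
`h = Λ^{−1/2}`), `exp{−Λ log²(X/n)} ≤ e^{−t²}`. [cite: Zhang2022LandauSiegel, §4 (4.2)–(4.3); §15 p.87] -/
theorem gaussLog_le_left {Λ X h : ℝ} (hX : 0 < X) (hΛ : 0 < Λ) (hh : h = 1 / Real.sqrt Λ)
    (t : ℕ) {n : ℕ} (hn0 : 0 < (n : ℝ)) (hn : (n : ℝ) ≤ X * Real.exp (-(t * h))) :
    Real.exp (-Λ * Real.log (X / n) ^ 2) ≤ Real.exp (-((t : ℝ) ^ 2)) := by
  have hx0 : 0 < X * Real.exp (-(t * h)) := by positivity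
  have hh0 : 0 ≤ h := by rw [hh]; positivity
  have hth : 0 ≤ (t : ℝ) * h := by positivity
  have hlog : (t : ℝ) * h ≤ Real.log (X / n) := by
    have h1 : Real.log (X / (X * Real.exp (-(t * h)))) ≤ Real.log (X / n) :=
      Real.log_le_log (div_pos hX hx0) (div_le_div_of_nonneg_left hX.le hn0 hn)
    have h2 : X / (X * Real.exp (-(t * h))) = Real.exp (t * h) := by
      rw [Real.exp_neg]; field_simp
    rwa [h2, Real.log_exp] at h1
  have hsq : ((t : ℝ) * h) ^ 2 ≤ Real.log (X / n) ^ 2 := pow_le_pow_left₀ hth hlog 2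
  have hh2 : Λ * h ^ 2 = 1 := by
    rw [hh, div_pow, one_pow, Real.sq_sqrt hΛ.le]; field_simp
  rw [Real.exp_le_exp]
  have := mul_le_mul_of_nonneg_left hsq hΛ.le
  calc -Λ * Real.log (X / n) ^ 2 ≤ -(Λ * ((t : ℝ) * h) ^ 2) := by linarith
    _ = -((t : ℝ) ^ 2 * (Λ * h ^ 2)) := by ring
    _ = -((t : ℝ) ^ 2) := by rw [hh2, mul_one]

/-- **Right half of the middle range** (induction over the blocks `(X e^{th}, X e^{(t+1)h}]`,
`t < M`, `Mh ≤ 2`): `Σ_{X<n≤Xe^{th}} … ≤ 2 h B (log X + 2)ᵏ Σ_{i<t} e^{−i²}`. [cite: Zhang2022LandauSiegel, §4 (4.2)–(4.3); §15 p.87] -/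
theorem sum_right_le (hf : ∀ n, 0 ≤ f n) (hB : 0 ≤ B) (hx₀ : 1 ≤ x₀)
    (hShort : ∀ x y : ℝ, x₀ ≤ x → Real.sqrt x ≤ y → y ≤ x →
      ∑ n ∈ Finset.Ioc ⌊x⌋₊ ⌊x + y⌋₊, f n ≤ B * y * Real.log x ^ k)
    {Λ X h : ℝ} (hh : h = 1 / Real.sqrt Λ) (hΛ : 4 ≤ Λ) (hX : x₀ ≤ X) (hXΛ : Λ ≤ X)
    {M : ℕ} (hM : (M : ℝ) * h ≤ 2) {t : ℕ} (ht : t ≤ M) :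
    ∑ n ∈ Finset.Ioc ⌊X⌋₊ ⌊X * Real.exp (t * h)⌋₊, f n / n * Real.exp (-Λ * Real.log (X / n) ^ 2) ≤
      2 * h * B * (Real.log X + 2) ^ k * ∑ i ∈ Finset.range t, Real.exp (-((i : ℝ) ^ 2)) := by
  have hΛ0 : 0 < Λ := by linarith
  have hX1 : 1 ≤ X := le_trans hx₀ hX
  have hX0 : 0 < X := by linarith
  have hh0 : 0 < h := by rw [hh]; positivity
  have hlogX : 0 ≤ Real.log X := Real.log_nonneg hX1
  induction t with
  | zero => simp
  | succ t ih =>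
    have ht' : t ≤ M := Nat.le_of_succ_le ht
    have hA := ih ht'
    -- the block `(X e^{th}, X e^{(t+1)h}]`
    set x : ℝ := X * Real.exp (t * h) with hxdef
    have hx1 : X ≤ x := by
      rw [hxdef]
      exact le_mul_of_one_le_right hX0.le (Real.one_le_exp (by positivity))
    have hxe : x * Real.exp h = X * Real.exp ((((t + 1 : ℕ)) : ℝ) * h) := by
      rw [hxdef, mul_assoc, ← Real.exp_add]
      congr 1; push_cast; ring_nf
    have hth : (t : ℝ) * h ≤ 2 := by
      calc (t : ℝ) * h ≤ (M : ℝ) * h := by gcongr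
        _ ≤ 2 := hM
    have hlogx : Real.log x ≤ Real.log X + 2 := by
      rw [hxdef, Real.log_mul hX0.ne' (Real.exp_pos _).ne', Real.log_exp]; linarith
    have hlogx0 : 0 ≤ Real.log x := Real.log_nonneg (le_trans hX1 hx1)
    have hblock := sum_block_le hf hB hx₀ hShort hh hΛ (le_trans hX hx1) (le_trans hXΛ hx1)
      (Real.exp_pos (-((t : ℝ) ^ 2))).le
      (fun n hn _ => gaussLog_le_right hX0 hΛ0 hh t (by rw [← hxdef]; exact hn))
    rw [hxe] at hblock
    have hmono' : ⌊x⌋₊ ≤ ⌊X * Real.exp ((((t + 1 : ℕ)) : ℝ) * h)⌋₊ := by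
      refine Nat.floor_le_floor ?_
      rw [← hxe]
      exact le_mul_of_one_le_right (by positivity) (Real.one_le_exp hh0.le)
    rw [← Finset.sum_Ioc_consecutive _ (Nat.floor_le_floor hx1) hmono', Finset.sum_range_succ,
      mul_add]
    refine add_le_add hA (le_trans hblock ?_)
    have hpow : Real.log x ^ k ≤ (Real.log X + 2) ^ k := pow_le_pow_left₀ hlogx0 hlogx k
    have : 0 ≤ 2 * h * B * Real.exp (-((t : ℝ) ^ 2)) := by positivity
    calc 2 * h * B * Real.exp (-((t : ℝ) ^ 2)) * Real.log x ^ k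
        ≤ 2 * h * B * Real.exp (-((t : ℝ) ^ 2)) * (Real.log X + 2) ^ k :=
          mul_le_mul_of_nonneg_left hpow this
      _ = 2 * h * B * (Real.log X + 2) ^ k * Real.exp (-((t : ℝ) ^ 2)) := by ring

/-- **Left half of the middle range** (induction over the blocks `(X e^{−(t+1)h}, X e^{−th}]`,
`t < M`, `Mh ≤ 2`, `X e^{−2} ≥ max(x₀, Λ)`): `Σ_{Xe^{−th}<n≤X} … ≤ 2 h B (log X + 2)ᵏ Σ_{i<t} e^{−i²}`.
[cite: Zhang2022LandauSiegel, §4 (4.2)–(4.3); §15 p.87] -/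
theorem sum_left_le (hf : ∀ n, 0 ≤ f n) (hB : 0 ≤ B) (hx₀ : 1 ≤ x₀)
    (hShort : ∀ x y : ℝ, x₀ ≤ x → Real.sqrt x ≤ y → y ≤ x →
      ∑ n ∈ Finset.Ioc ⌊x⌋₊ ⌊x + y⌋₊, f n ≤ B * y * Real.log x ^ k)
    {Λ X h : ℝ} (hh : h = 1 / Real.sqrt Λ) (hΛ : 4 ≤ Λ) (hX : Real.exp 2 * x₀ ≤ X)
    (hXΛ : Real.exp 2 * Λ ≤ X) {M : ℕ} (hM : (M : ℝ) * h ≤ 2) {t : ℕ} (ht : t ≤ M) :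
    ∑ n ∈ Finset.Ioc ⌊X * Real.exp (-(t * h))⌋₊ ⌊X⌋₊,
        f n / n * Real.exp (-Λ * Real.log (X / n) ^ 2) ≤
      2 * h * B * (Real.log X + 2) ^ k * ∑ i ∈ Finset.range t, Real.exp (-((i : ℝ) ^ 2)) := by
  have hΛ0 : 0 < Λ := by linarith
  have he2 : 1 ≤ Real.exp 2 := Real.one_le_exp (by norm_num)
  have hX1 : 1 ≤ X := by nlinarith
  have hX0 : 0 < X := by linarith
  have hh0 : 0 < h := by rw [hh]; positivity
  have hlogX : 0 ≤ Real.log X := Real.log_nonneg hX1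
  induction t with
  | zero => simp
  | succ t ih =>
    have ht' : t ≤ M := Nat.le_of_succ_le ht
    have hA := ih ht'
    -- the block `(X e^{−(t+1)h}, X e^{−th}]`
    set x : ℝ := X * Real.exp (-((((t + 1 : ℕ)) : ℝ) * h)) with hxdef
    have hxe : x * Real.exp h = X * Real.exp (-(t * h)) := by
      rw [hxdef, mul_assoc, ← Real.exp_add]
      congr 1; push_cast; ring_nf
    have hth : (((t + 1 : ℕ)) : ℝ) * h ≤ 2 := by
      calc (((t + 1 : ℕ)) : ℝ) * h ≤ (M : ℝ) * h := by gcongr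
        _ ≤ 2 := hM
    have hx2 : X * Real.exp (-2) ≤ x := by
      rw [hxdef]
      exact mul_le_mul_of_nonneg_left (Real.exp_le_exp.mpr (by linarith)) hX0.le
    have hXe : X * Real.exp (-2) = X / Real.exp 2 := by rw [Real.exp_neg, div_eq_mul_inv]
    have hx₀x : x₀ ≤ x := by
      refine le_trans ?_ hx2
      rw [hXe, le_div_iff₀ (by positivity)]; linarith
    have hΛx : Λ ≤ x := by
      refine le_trans ?_ hx2
      rw [hXe, le_div_iff₀ (by positivity)]; linarith
    have hxX : x ≤ X := by
      rw [hxdef]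
      exact mul_le_of_le_one_right hX0.le (Real.exp_le_one_iff.mpr (by
        have : 0 ≤ (((t + 1 : ℕ)) : ℝ) * h := by positivity
        linarith))
    have hlogx : Real.log x ≤ Real.log X + 2 := by
      have := Real.log_le_log (by linarith [le_trans hx₀ hx₀x]) hxX
      linarith
    have hlogx0 : 0 ≤ Real.log x := Real.log_nonneg (le_trans hx₀ hx₀x)
    have hxpos : 0 < x := by linarith [le_trans hx₀ hx₀x]
    have hblock := sum_block_le hf hB hx₀ hShort hh hΛ hx₀x hΛx
      (Real.exp_pos (-((t : ℝ) ^ 2))).le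
      (fun n hn hn' => gaussLog_le_left hX0 hΛ0 hh t (lt_trans hxpos hn) (by rwa [← hxe]))
    rw [hxe] at hblock
    have hmono : ⌊x⌋₊ ≤ ⌊X * Real.exp (-(t * h))⌋₊ := by
      refine Nat.floor_le_floor ?_
      rw [← hxe]
      exact le_mul_of_one_le_right hxpos.le (Real.one_le_exp hh0.le)
    have hmono' : ⌊X * Real.exp (-(t * h))⌋₊ ≤ ⌊X⌋₊ := by
      refine Nat.floor_le_floor (mul_le_of_le_one_right hX0.le (Real.exp_le_one_iff.mpr ?_))
      have : 0 ≤ (t : ℝ) * h := by positivity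
      linarith
    rw [← Finset.sum_Ioc_consecutive _ hmono hmono', Finset.sum_range_succ, mul_add, add_comm]
    refine add_le_add hA (le_trans hblock ?_)
    have hpow : Real.log x ^ k ≤ (Real.log X + 2) ^ k := pow_le_pow_left₀ hlogx0 hlogx k
    have : 0 ≤ 2 * h * B * Real.exp (-((t : ℝ) ^ 2)) := by positivity
    calc 2 * h * B * Real.exp (-((t : ℝ) ^ 2)) * Real.log x ^ k
        ≤ 2 * h * B * Real.exp (-((t : ℝ) ^ 2)) * (Real.log X + 2) ^ k :=
          mul_le_mul_of_nonneg_left hpow this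
      _ = 2 * h * B * (Real.log X + 2) ^ k * Real.exp (-((t : ℝ) ^ 2)) := by ring

end FineBlocks

/-! ## §6. Assembly: the Gaussian window bound and the unsmoothing theorem -/

section Assembly

variable {f : ℕ → ℝ} {k : ℕ} {B x₀ : ℝ}

/-- **The Gaussian window bound (finite form).** Let `f ≥ 0` satisfy the short-interval bound
`Σ_{x<n≤x+y} f(n) ≤ B y logᵏx` (`x ≥ x₀ ≥ 1`, `√x ≤ y ≤ x`) and `Σ_{1≤n≤x₀} f(n) ≤ F`. Then for
`X ≥ e²·max(x₀, Λ)` and `Λ ≥ max(4, (k+1)/2)`, uniformly in `N`,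
`Σ_{1≤n≤N} f(n) n⁻¹ exp{−Λ log²(X/n)} ≤ 3^{k+3}(B logᵏX + F)/√Λ`. [cite: Zhang2022LandauSiegel, §4 (4.2)–(4.3); §15 p.87] -/
theorem sum_div_mul_gaussLog_le (hf : ∀ n, 0 ≤ f n) (hB : 0 ≤ B) (hx₀ : 1 ≤ x₀)
    (hShort : ∀ x y : ℝ, x₀ ≤ x → Real.sqrt x ≤ y → y ≤ x →
      ∑ n ∈ Finset.Ioc ⌊x⌋₊ ⌊x + y⌋₊, f n ≤ B * y * Real.log x ^ k)
    {F : ℝ} (hSmall : ∑ n ∈ Finset.Icc 1 ⌊x₀⌋₊, f n ≤ F) (hF : 0 ≤ F)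
    {Λ X : ℝ} (hΛ : 4 ≤ Λ) (hΛk : (k : ℝ) + 1 ≤ 2 * Λ) (hX : Real.exp 2 * x₀ ≤ X)
    (hΛX : Real.exp 2 * Λ ≤ X) (N : ℕ) :
    ∑ n ∈ Finset.Icc 1 N, f n / n * Real.exp (-Λ * Real.log (X / n) ^ 2) ≤
      3 ^ (k + 3) * (B * Real.log X ^ k + F) / Real.sqrt Λ := by
  -- the parameters `h = Λ^{−1/2}`, `M = ⌈√Λ⌉`, `1 ≤ Mh ≤ 2`
  have hΛ0 : 0 < Λ := by linarith
  have hΛ1 : 1 ≤ Λ := by linarith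
  have hsΛ : 2 ≤ Real.sqrt Λ := by
    rw [show (2 : ℝ) = Real.sqrt 4 by rw [show (4 : ℝ) = 2 ^ 2 by norm_num,
      Real.sqrt_sq (by norm_num : (0 : ℝ) ≤ 2)]]
    exact Real.sqrt_le_sqrt hΛ
  have hsΛ0 : 0 < Real.sqrt Λ := by linarith
  set h : ℝ := 1 / Real.sqrt Λ with hh
  have hh0 : 0 < h := by rw [hh]; positivity
  have hh1 : h ≤ 1 / 2 := by rw [hh, div_le_div_iff₀ hsΛ0 two_pos]; linarith
  set M : ℕ := ⌈Real.sqrt Λ⌉₊ with hMdef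
  have hM1 : 1 ≤ (M : ℝ) * h := by
    have : Real.sqrt Λ ≤ M := Nat.le_ceil _
    rw [hh, mul_one_div, one_le_div hsΛ0]; exact this
  have hM2 : (M : ℝ) * h ≤ 2 := by
    have h1 : (M : ℝ) < Real.sqrt Λ + 1 := Nat.ceil_lt_add_one hsΛ0.le
    have h2 : (M : ℝ) * h ≤ (Real.sqrt Λ + 1) * h := mul_le_mul_of_nonneg_right h1.le hh0.le
    have h3 : (Real.sqrt Λ + 1) * h = 1 + h := by rw [hh]; field_simp
    linarith
  have he1 : (1 : ℝ) ≤ Real.exp 1 := Real.one_le_exp zero_le_one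
  have he2 : (1 : ℝ) ≤ Real.exp 2 := Real.one_le_exp (by norm_num)
  have hXx₀ : x₀ ≤ X := le_trans (le_mul_of_one_le_left (by linarith) he2) hX
  have hXΛ' : Λ ≤ X := le_trans (le_mul_of_one_le_left (by linarith) he2) hΛX
  have hX1 : 1 ≤ X := le_trans hx₀ hXx₀
  have hX0 : 0 < X := by linarith
  have hlogX2 : 2 ≤ Real.log X := by
    rw [Real.le_log_iff_exp_le hX0]
    exact le_trans (le_mul_of_one_le_right (Real.exp_pos _).le hx₀) hX
  have hlogX0 : 0 ≤ Real.log X := by linarith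
  -- the cut points `Y₀ = X e^{−Mh} ≤ X ≤ Y₁ = X e^{Mh}`
  have hY₀X : X * Real.exp (-((M : ℝ) * h)) ≤ X :=
    mul_le_of_le_one_right hX0.le (Real.exp_le_one_iff.mpr (by linarith))
  have hXY₁ : X ≤ X * Real.exp ((M : ℝ) * h) :=
    le_mul_of_one_le_right hX0.le (Real.one_le_exp (by positivity))
  have hY₀ge : x₀ ≤ X * Real.exp (-((M : ℝ) * h)) := by
    have h1 : Real.exp (-2) ≤ Real.exp (-((M : ℝ) * h)) := Real.exp_le_exp.mpr (by linarith)
    have h2 : x₀ ≤ X * Real.exp (-2) := by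
      rw [Real.exp_neg, ← div_eq_mul_inv, le_div_iff₀ (by positivity)]; linarith
    exact le_trans h2 (mul_le_mul_of_nonneg_left h1 hX0.le)
  have hY₀le : X * Real.exp (-((M : ℝ) * h)) ≤ X / Real.exp 1 := by
    rw [div_eq_mul_inv, ← Real.exp_neg]
    exact mul_le_mul_of_nonneg_left (Real.exp_le_exp.mpr (by linarith)) hX0.le
  have hY₁ge : Real.exp 1 * X ≤ X * Real.exp ((M : ℝ) * h) := by
    rw [mul_comm]
    exact mul_le_mul_of_nonneg_left (Real.exp_le_exp.mpr hM1) hX0.le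
  have hY₁x₀ : x₀ ≤ X * Real.exp ((M : ℝ) * h) := le_trans hXx₀ hXY₁
  have hY₀1 : 1 ≤ X * Real.exp (-((M : ℝ) * h)) := le_trans hx₀ hY₀ge
  -- reduce to `N ≥ ⌊Y₁⌋`
  set N' : ℕ := max N ⌊X * Real.exp ((M : ℝ) * h)⌋₊ with hN'
  have hterm0 : ∀ n : ℕ, 0 ≤ f n / n * Real.exp (-Λ * Real.log (X / n) ^ 2) := fun n =>
    mul_nonneg (div_nonneg (hf n) (Nat.cast_nonneg n)) (Real.exp_pos _).le
  have hmono : ∑ n ∈ Finset.Icc 1 N, f n / n * Real.exp (-Λ * Real.log (X / n) ^ 2) ≤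
      ∑ n ∈ Finset.Icc 1 N', f n / n * Real.exp (-Λ * Real.log (X / n) ^ 2) :=
    Finset.sum_le_sum_of_subset_of_nonneg (Finset.Icc_subset_Icc_right (le_max_left _ _))
      fun n _ _ => hterm0 n
  refine le_trans hmono ?_
  -- split `(0, N'] = (0, ⌊Y₀⌋] ∪ (⌊Y₀⌋, ⌊X⌋] ∪ (⌊X⌋, ⌊Y₁⌋] ∪ (⌊Y₁⌋, N']`
  have hc1 : ⌊X * Real.exp (-((M : ℝ) * h))⌋₊ ≤ ⌊X⌋₊ := Nat.floor_le_floor hY₀X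
  have hc2 : ⌊X⌋₊ ≤ ⌊X * Real.exp ((M : ℝ) * h)⌋₊ := Nat.floor_le_floor hXY₁
  have hc3 : ⌊X * Real.exp ((M : ℝ) * h)⌋₊ ≤ N' := le_max_right _ _
  rw [Icc_one_eq_Ioc_zero,
    ← Finset.sum_Ioc_consecutive _ (Nat.zero_le ⌊X * Real.exp (-((M : ℝ) * h))⌋₊)
      (le_trans hc1 (le_trans hc2 hc3)),
    ← Finset.sum_Ioc_consecutive _ hc1 (le_trans hc2 hc3),
    ← Finset.sum_Ioc_consecutive _ hc2 hc3]
  -- the four pieces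
  have hlow := sum_low_le hf hB hx₀ hShort hSmall hΛ1 hX0 hY₀ge hY₀le
  rw [Icc_one_eq_Ioc_zero] at hlow
  have hleft := sum_left_le hf hB hx₀ hShort hh hΛ hX hΛX hM2 (le_refl M)
  have hright := sum_right_le hf hB hx₀ hShort hh hΛ hXx₀ hXΛ' hM2 (le_refl M)
  have hhigh := sum_high_le hf hB hx₀ hShort hΛ0.le hΛk hX1 hY₁ge hY₁x₀ N'
  have hG2 := sum_exp_neg_sq_le_two M
  -- bookkeeping of the constants
  set L : ℝ := Real.log X + 2 with hL
  set G : ℝ := Real.log X ^ k with hG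
  have hG0 : 0 ≤ G := pow_nonneg hlogX0 k
  have hL0 : 0 ≤ L := by linarith
  have hLk : L ^ k ≤ 2 ^ k * G := by
    rw [hG, ← mul_pow]; exact pow_le_pow_left₀ hL0 (by linarith) k
  have hGL : G ≤ L ^ k := pow_le_pow_left₀ hlogX0 (by linarith) k
  have hLk0 : 0 ≤ L ^ k := pow_nonneg hL0 k
  -- `e^{−Λ} ≤ e^{1−Λ} ≤ h`
  have hE1 : Real.exp (1 - Λ) ≤ h := by
    have h1 : Real.sqrt Λ ≤ Real.exp (Λ - 1) :=
      le_trans (sqrt_le_self_of_one_le hΛ1) (by linarith [Real.add_one_le_exp (Λ - 1)])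
    rw [hh, show (1 : ℝ) - Λ = -(Λ - 1) by ring, Real.exp_neg, ← one_div]
    exact one_div_le_one_div_of_le hsΛ0 h1
  have hE : Real.exp (-Λ) ≤ h := le_trans (Real.exp_le_exp.mpr (by linarith)) hE1
  -- low piece
  have hlow' : ∑ n ∈ Finset.Ioc 0 ⌊X * Real.exp (-((M : ℝ) * h))⌋₊,
      f n / n * Real.exp (-Λ * Real.log (X / n) ^ 2) ≤ h * F + 2 * h * B * L ^ k := by
    refine le_trans hlow ?_
    have hlogY : Real.log (X * Real.exp (-((M : ℝ) * h))) ^ k ≤ G :=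
      pow_le_pow_left₀ (Real.log_nonneg hY₀1) (Real.log_le_log (by linarith) hY₀X) k
    have h1 : 2 * B * (X * Real.exp (-((M : ℝ) * h))) *
        Real.log (X * Real.exp (-((M : ℝ) * h))) ^ k ≤ 2 * B * X * G := by
      calc _ ≤ 2 * B * X * Real.log (X * Real.exp (-((M : ℝ) * h))) ^ k := by
            gcongr
            exact pow_nonneg (Real.log_nonneg hY₀1) k
        _ ≤ 2 * B * X * G := mul_le_mul_of_nonneg_left hlogY (by positivity)
    have h2 : Real.exp (1 - Λ) / X * (F + 2 * B * (X * Real.exp (-((M : ℝ) * h))) *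
        Real.log (X * Real.exp (-((M : ℝ) * h))) ^ k) ≤
        Real.exp (1 - Λ) / X * (F + 2 * B * X * G) :=
      mul_le_mul_of_nonneg_left (by linarith) (by positivity)
    refine le_trans h2 ?_
    have h3 : Real.exp (1 - Λ) / X * (F + 2 * B * X * G) =
        Real.exp (1 - Λ) * (F / X) + 2 * Real.exp (1 - Λ) * B * G := by
      field_simp
    rw [h3]
    have h4 : F / X ≤ F := div_le_self hF hX1
    have h5 : Real.exp (1 - Λ) * (F / X) ≤ h * F :=
      mul_le_mul hE1 h4 (div_nonneg hF hX0.le) hh0.le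
    have h6 : 2 * Real.exp (1 - Λ) * B * G ≤ 2 * h * B * L ^ k := by
      have : Real.exp (1 - Λ) * G ≤ h * L ^ k := mul_le_mul hE1 hGL hG0 hh0.le
      calc 2 * Real.exp (1 - Λ) * B * G = (2 * B) * (Real.exp (1 - Λ) * G) := by ring
        _ ≤ (2 * B) * (h * L ^ k) := mul_le_mul_of_nonneg_left this (by positivity)
        _ = 2 * h * B * L ^ k := by ring
    linarith
  -- high piece
  have hhigh' : ∑ n ∈ Finset.Ioc ⌊X * Real.exp ((M : ℝ) * h)⌋₊ N',
      f n / n * Real.exp (-Λ * Real.log (X / n) ^ 2) ≤ 2 * h * B * L ^ k := by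
    refine le_trans hhigh ?_
    have hlogY0 : 0 ≤ Real.log (X * Real.exp ((M : ℝ) * h)) ^ k :=
      pow_nonneg (Real.log_nonneg (le_trans hX1 hXY₁)) k
    have hlogY : Real.log (X * Real.exp ((M : ℝ) * h)) ^ k ≤ L ^ k := by
      refine pow_le_pow_left₀ (Real.log_nonneg (le_trans hX1 hXY₁)) ?_ k
      rw [Real.log_mul hX0.ne' (Real.exp_pos _).ne', Real.log_exp, hL]; linarith
    calc 2 * B * Real.exp (-Λ) * Real.log (X * Real.exp ((M : ℝ) * h)) ^ k
        ≤ 2 * B * h * L ^ k :=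
          mul_le_mul (mul_le_mul_of_nonneg_left hE (by positivity)) hlogY hlogY0 (by positivity)
      _ = 2 * h * B * L ^ k := by ring
  -- middle pieces
  have hleft' : ∑ n ∈ Finset.Ioc ⌊X * Real.exp (-((M : ℝ) * h))⌋₊ ⌊X⌋₊,
      f n / n * Real.exp (-Λ * Real.log (X / n) ^ 2) ≤ 4 * h * B * L ^ k := by
    refine le_trans hleft ?_
    calc 2 * h * B * (Real.log X + 2) ^ k * ∑ i ∈ Finset.range M, Real.exp (-((i : ℝ) ^ 2))
        ≤ 2 * h * B * (Real.log X + 2) ^ k * 2 := by gcongr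
      _ = 4 * h * B * L ^ k := by rw [hL]; ring
  have hright' : ∑ n ∈ Finset.Ioc ⌊X⌋₊ ⌊X * Real.exp ((M : ℝ) * h)⌋₊,
      f n / n * Real.exp (-Λ * Real.log (X / n) ^ 2) ≤ 4 * h * B * L ^ k := by
    refine le_trans hright ?_
    calc 2 * h * B * (Real.log X + 2) ^ k * ∑ i ∈ Finset.range M, Real.exp (-((i : ℝ) ^ 2))
        ≤ 2 * h * B * (Real.log X + 2) ^ k * 2 := by gcongr
      _ = 4 * h * B * L ^ k := by rw [hL]; ring
  -- total
  have htot := add_le_add hlow' (add_le_add hleft' (add_le_add hright' hhigh'))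
  refine le_trans htot ?_
  have h23 : (2 : ℝ) ^ k ≤ 3 ^ k := pow_le_pow_left₀ (by norm_num) (by norm_num) k
  have h3k : (1 : ℝ) ≤ 3 ^ k := one_le_pow₀ (by norm_num)
  have hfin : h * F + 2 * h * B * L ^ k + (4 * h * B * L ^ k + (4 * h * B * L ^ k + 2 * h * B * L ^ k))
      = h * (F + 12 * B * L ^ k) := by ring
  rw [hfin, hh, one_div, inv_mul_eq_div]
  refine div_le_div_of_nonneg_right ?_ hsΛ0.le
  have h12 : 12 * B * L ^ k ≤ 12 * B * (2 ^ k * G) := mul_le_mul_of_nonneg_left hLk (by positivity)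
  have hBG : 0 ≤ B * G := mul_nonneg hB hG0
  calc F + 12 * B * L ^ k ≤ F + 12 * B * (2 ^ k * G) := by linarith
    _ = F + 12 * 2 ^ k * (B * G) := by ring
    _ ≤ 3 ^ (k + 3) * F + 27 * 3 ^ k * (B * G) := by
        have h3k0 : (0 : ℝ) ≤ 3 ^ k := by positivity
        have h1 : 12 * 2 ^ k * (B * G) ≤ 27 * 3 ^ k * (B * G) := by
          refine mul_le_mul_of_nonneg_right ?_ hBG
          calc (12 : ℝ) * 2 ^ k ≤ 12 * 3 ^ k := mul_le_mul_of_nonneg_left h23 (by norm_num)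
            _ ≤ 27 * 3 ^ k := by linarith
        have h2 : F ≤ 3 ^ (k + 3) * F := le_mul_of_one_le_left hF (one_le_pow₀ (by norm_num))
        linarith
    _ = 3 ^ (k + 3) * (B * Real.log X ^ k + F) := by rw [hG, pow_add]; ring

/-- **The Gaussian window bound.** Under the hypotheses of `sum_div_mul_gaussLog_le` the window
series `Σ_n f(n) n⁻¹ exp{−Λ log²(X/n)}` converges and is `≤ 3^{k+3}(B logᵏX + F)/√Λ`. [cite: Zhang2022LandauSiegel, §4 (4.2)–(4.3); §15 p.87] -/
theorem tsum_div_mul_gaussLog_le (hf : ∀ n, 0 ≤ f n) (hB : 0 ≤ B) (hx₀ : 1 ≤ x₀)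
    (hShort : ∀ x y : ℝ, x₀ ≤ x → Real.sqrt x ≤ y → y ≤ x →
      ∑ n ∈ Finset.Ioc ⌊x⌋₊ ⌊x + y⌋₊, f n ≤ B * y * Real.log x ^ k)
    {F : ℝ} (hSmall : ∑ n ∈ Finset.Icc 1 ⌊x₀⌋₊, f n ≤ F) (hF : 0 ≤ F)
    {Λ X : ℝ} (hΛ : 4 ≤ Λ) (hΛk : (k : ℝ) + 1 ≤ 2 * Λ) (hX : Real.exp 2 * x₀ ≤ X)
    (hΛX : Real.exp 2 * Λ ≤ X) :
    Summable (fun n : ℕ => f n / n * Real.exp (-Λ * Real.log (X / n) ^ 2)) ∧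
      ∑' n : ℕ, f n / n * Real.exp (-Λ * Real.log (X / n) ^ 2) ≤
        3 ^ (k + 3) * (B * Real.log X ^ k + F) / Real.sqrt Λ := by
  have hterm0 : ∀ n : ℕ, 0 ≤ f n / n * Real.exp (-Λ * Real.log (X / n) ^ 2) := fun n =>
    mul_nonneg (div_nonneg (hf n) (Nat.cast_nonneg n)) (Real.exp_pos _).le
  have hbound : ∀ u : Finset ℕ, ∑ n ∈ u, f n / n * Real.exp (-Λ * Real.log (X / n) ^ 2) ≤
      3 ^ (k + 3) * (B * Real.log X ^ k + F) / Real.sqrt Λ := by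
    intro u
    have h0 : f 0 / ((0 : ℕ) : ℝ) * Real.exp (-Λ * Real.log (X / ((0 : ℕ) : ℝ)) ^ 2) = 0 := by
      simp
    rw [← Finset.sum_erase u h0]
    have hsub : u.erase 0 ⊆ Finset.Icc 1 (u.sup id) := by
      intro n hn
      rw [Finset.mem_erase] at hn
      rw [Finset.mem_Icc]
      exact ⟨Nat.one_le_iff_ne_zero.mpr hn.1, Finset.le_sup (f := id) hn.2⟩
    exact le_trans (Finset.sum_le_sum_of_subset_of_nonneg hsub fun n _ _ => hterm0 n)
      (sum_div_mul_gaussLog_le hf hB hx₀ hShort hSmall hF hΛ hΛk hX hΛX (u.sup id))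
  have hs : Summable (fun n : ℕ => f n / n * Real.exp (-Λ * Real.log (X / n) ^ 2)) :=
    summable_of_sum_le hterm0 hbound
  exact ⟨hs, hs.tsum_le_of_sum_le hbound⟩

/-- **Unsmoothing theorem** (the summed form of "by (4.2) and (4.3)"): for coefficients `a` with a
majorant `f ≥ |a|` obeying the short-interval bound `Σ_{x<n≤x+y} f(n) ≤ B y logᵏx`
(`x ≥ x₀ ≥ 1`, `√x ≤ y ≤ x`; the shape of Shiu's theorem) and `Σ_{n≤x₀} f(n) ≤ F`, and for
`X ≥ e²·max(x₀, Λ)`, `Λ ≥ max(4, (k+1)/2)`: the smoothed series converges and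
`‖Σ_{1≤n<X} a(n)/n − Σ_n a(n) n⁻¹ g(X/n)‖ ≤ 3^{k+3}(B logᵏX + F)/(2√Λ)`
(`g = GaussWeight.gWeight Λ`, Zhang's (4.1)). [cite: Zhang2022LandauSiegel, §4 (4.2)–(4.3)] -/
theorem norm_sum_Ico_sub_tsum_mul_gWeight_le_of_shortInterval {a : ℕ → ℂ}
    (hf : ∀ n, 0 ≤ f n) (haf : ∀ n : ℕ, 1 ≤ n → ‖a n‖ ≤ f n) (hB : 0 ≤ B) (hx₀ : 1 ≤ x₀)
    (hShort : ∀ x y : ℝ, x₀ ≤ x → Real.sqrt x ≤ y → y ≤ x →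
      ∑ n ∈ Finset.Ioc ⌊x⌋₊ ⌊x + y⌋₊, f n ≤ B * y * Real.log x ^ k)
    {F : ℝ} (hSmall : ∑ n ∈ Finset.Icc 1 ⌊x₀⌋₊, f n ≤ F) (hF : 0 ≤ F)
    {Λ X : ℝ} (hΛ : 4 ≤ Λ) (hΛk : (k : ℝ) + 1 ≤ 2 * Λ) (hX : Real.exp 2 * x₀ ≤ X)
    (hΛX : Real.exp 2 * Λ ≤ X) :
    Summable (fun n : ℕ => a n / n * (gWeight Λ (X / n) : ℂ)) ∧
      ‖(∑ n ∈ Finset.Ico 1 ⌈X⌉₊, a n / n) - ∑' n : ℕ, a n / n * (gWeight Λ (X / n) : ℂ)‖ ≤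
        3 ^ (k + 3) * (B * Real.log X ^ k + F) / Real.sqrt Λ / 2 := by
  have hΛ0 : 0 < Λ := by linarith
  have hX0 : 0 < X := by
    have he2 : (1 : ℝ) ≤ Real.exp 2 := Real.one_le_exp (by norm_num)
    nlinarith
  obtain ⟨hs, hle⟩ := tsum_div_mul_gaussLog_le hf hB hx₀ hShort hSmall hF hΛ hΛk hX hΛX
  obtain ⟨hsm, hn⟩ := norm_sum_Ico_sub_tsum_mul_gWeight_le hΛ0 hX0 a f haf hs
  exact ⟨hsm, le_trans hn (by linarith)⟩

end Assembly

end Literature.NumberTheory.LFunctions.Zhang2022.GaussWeight
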